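import Literature.Computability.MetaComplexity.UPSearchAssembly
import Literature.Computability.MetaComplexity.LanguageCompressionProofs
import Literature.Computability.MetaComplexity.DPReconstruction
import HarnessLib

/-!
# Complexity meta: Thm. 8.9 of Hirahara 2021 for `UP` — the named fact reduced to its three remaining leaves

Sibling proof file of `SearchHeuristicSchemes.lean` for the named fact
`Hirahara2021_UP_searchUHS_of_Avg1P` (S. Hirahara, *Average-case hardness of NP from exponential
worst-case hardness assumptions*, STOC 2021; full version ECCC TR21-058, Thm. 8.9 restricted along
Fact 8.4 to `UP`-type verifiers: *if `coNP × {U, T} ⊆ Avg¹_{1-n^{-c}} P` for some constant `c`, then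
the search problem of every `UP`-type verifier admits a universal heuristic scheme*, Def. 8.8).

`UPSearchAssembly.lean` proves the fact from the five results of §3–§5 that the printed proof
(pp. 40–42) invokes (`Hirahara2021_UP_searchUHS_of_Avg1P_of`, hypotheses `h51 h42 h52 h34 h312`).
Two of those five are meanwhile theorems of the tree relative to the others:

* Lemma 5.1 (`h51`, the named fact `Hirahara2021_gapKvsK_mem_PromiseP`) follows from Thm. 4.2
  (`h42`, the named fact `Hirahara2021_languageCompression`) by the half-page argument of p. 29 —
  `Hirahara2021_gapKvsK_mem_PromiseP_of_languageCompression` (`LanguageCompressionProofs.lean`);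
* Thm. 3.12 in enumeration form (`h312`) holds under `PromiseBPP' ⊆ PromiseP`, the conclusion of
  Lemma 3.4 in promise form (`h34`) — `Hirahara2021_dpEnum_of_PromiseBPP'_subset`
  (`DPReconstruction.lean`: Goldreich–Levin, Rackoff's pairwise independent decoder, enumeration of
  the heavy outputs of a randomised polynomial-time function under `pr-BPP = pr-P`).

Hence the fact rests on exactly three leaves, which this file records as one theorem:

* `Hirahara2021_UP_searchUHS_of_Avg1P_of_leaves` — **Thm. 8.9 (`UP` form) from Thm. 4.2 (the named
  fact `Hirahara2021_languageCompression`), Lemma 3.4 in promise form (`h34`: the hypothesis implies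
  `pr-BPP = pr-P`; p. 20, used on p. 27 and in Eq. (13)) and Thm. 5.2 in its printed form (`h52`,
  weak symmetry of information, p. 30)**; the last two are inline hypotheses exactly as in
  `Hirahara2021_UP_searchUHS_of_Avg1P_of` (no named fact is introduced, D-0026).

The discharge `Hirahara2021_UP_searchUHS_of_Avg1P_holds` is this theorem fed
`Hirahara2021_languageCompression_holds` and proofs of `h34`, `h52`, once those exist. What they
need (recorded for the cone; ECCC TR21-058 open at the cited pages): `h34` is Lemma 3.4 from the
*weak* hypothesis — (1) `coNP × {T} ⊆ Avg¹_{1-n^{-c}} P ⟹ NE = E` [BCGL92], (2)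
`coNP × {U} ⊆ Avg¹_{1-n^{-c}} P ⟹ pr-MA = pr-NP` [KS04], (3) `NE = E ∧ pr-MA = pr-NP ⟹
E ⊄ i.o.SIZE(2^{εn})` [BFP05], (4) [IW97] (in the tree: `impagliazzo_wigderson_holds`,
`PromiseBPP'_subset_PromiseP_of_avgHard_E`); `h52` is proved on p. 30 from Lemma 5.1, Fact 3.7 and
Thm. 3.12 in its Kolmogorov form (see `UPSearchAssembly.lean`, "Size of what remains"); Thm. 4.2
(pp. 26–29) needs Lemma 3.4, Lemma 3.6, the Goldwasser–Sipser protocol (Lemmas 4.5–4.6) and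
Thm. 3.12 in Kolmogorov form.

## References

* S. Hirahara, ECCC TR21-058 (2021): Thm. 8.9 and its proof (pp. 40–42), Lemma 3.4 (p. 20),
  Thm. 3.12 and the remark following it (p. 23), Thm. 4.2 (p. 26), Lemma 5.1 (p. 29), Thm. 5.2
  (p. 30), Def. 8.8, Fact 8.4 (p. 37).
-/

namespace Literature.Computability.MetaComplexity

open _root_.Computability Complexity Complexity.Classes Complexity.Nondeterministic Brick

/-- **Hirahara 2021, Thm. 8.9 for `UP`-type verifiers, from its three remaining leaves.** The named
fact `Hirahara2021_UP_searchUHS_of_Avg1P` follows from Thm. 4.2 (`Hirahara2021_languageCompression`),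
Lemma 3.4 in promise form (`h34`: *if `coNP × {U, T} ⊆ Avg¹_{1-n^{-c}} P` for some `c` then
`pr-BPP = pr-P`*, as the paper uses Lemma 3.4 on p. 27 and in Eq. (13)) and Thm. 5.2 in its printed
form (`h52`: *under the hypothesis there are polynomials `p₀, p_w` with
`Pr_{w ← {0,1}^m}[K^t(xw) ≥ K^{p_w(t/ε)}(x) + m - log p_w(t/ε)] ≥ 1 - ε` for all `n, m`, `t ≥ p₀(nm)`,
`ε = 1/e`, `x ∈ {0,1}ⁿ`*, in `ℕ∞` without subtraction, `∀ U`): Lemma 5.1 is Thm. 4.2 applied to the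
ensemble `{x | K^t(x) ≤ s}` (`Hirahara2021_gapKvsK_mem_PromiseP_of_languageCompression`, p. 29), the
enumeration form of Thm. 3.12 holds under `pr-BPP = pr-P` (`Hirahara2021_dpEnum_of_PromiseBPP'_subset`,
p. 23), and the five ingredients give the scheme (`Hirahara2021_UP_searchUHS_of_Avg1P_of`, the
formalised proof of Thm. 8.9, pp. 40–42).
[Hirahara 2021 (ECCC TR21-058), Thm. 8.9 with Lemma 3.4, Thm. 3.12, Thm. 4.2, Lemma 5.1, Thm. 5.2,
Fact 8.4] [cite: Hirahara2021, Thm. 8.9] -/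
theorem Hirahara2021_UP_searchUHS_of_Avg1P_of_leaves (h42 : Hirahara2021_languageCompression)
    (h34 : (∃ c : ℕ, distClass coNP {uniformEnsemble, tallyEnsemble} ⊆
        Avg1DeltaP fun n => 1 - 1 / (n : ℝ) ^ c) → PromiseBPP' ⊆ PromiseP)
    (h52 : ∀ U : UniversalMachine,
      (∃ c : ℕ, distClass coNP {uniformEnsemble, tallyEnsemble} ⊆
        Avg1DeltaP fun n => 1 - 1 / (n : ℝ) ^ c) →
      ∃ p₀ pw : Polynomial ℕ, ∀ (n m t e : ℕ) (x : List Bool), x.length = n → p₀.eval (n * m) ≤ t →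
        1 ≤ e →
          1 - 1 / (e : ℝ) ≤ uniformProb m
            {w | U.ktAt (pw.eval (t * e)) x + m ≤ U.ktAt t (x ++ w) + Nat.log 2 (pw.eval (t * e))}) :
    Hirahara2021_UP_searchUHS_of_Avg1P :=
  Hirahara2021_UP_searchUHS_of_Avg1P_of (Hirahara2021_gapKvsK_mem_PromiseP_of_languageCompression h42)
    h42 h52 h34 fun hyp => Hirahara2021_dpEnum_of_PromiseBPP'_subset (h34 hyp)

/-- **Cor. 8.12 for `UP` from the same three leaves** (the conclusion written out exactly as in
`Hirahara2021_UP_hasUHS_of_Avg1P_of_search`: *if `coNP × {U, T} ⊆ Avg¹_{1-n^{-c}} P` for some `c`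
then every `L ∈ UP` admits a universal heuristic scheme*): Thm. 8.9 for the `UP`-type verifier of
`L`, then "a decision problem reduces to its search version" (proof of Cor. 8.12, p. 42).
[Hirahara 2021 (ECCC TR21-058), Cor. 8.12 with Thm. 8.9 and Fact 8.4] [cite: Hirahara2021, Cor. 8.12] -/
theorem Hirahara2021_UP_hasUHS_of_Avg1P_of_leaves (h42 : Hirahara2021_languageCompression)
    (h34 : (∃ c : ℕ, distClass coNP {uniformEnsemble, tallyEnsemble} ⊆
        Avg1DeltaP fun n => 1 - 1 / (n : ℝ) ^ c) → PromiseBPP' ⊆ PromiseP)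
    (h52 : ∀ U : UniversalMachine,
      (∃ c : ℕ, distClass coNP {uniformEnsemble, tallyEnsemble} ⊆
        Avg1DeltaP fun n => 1 - 1 / (n : ℝ) ^ c) →
      ∃ p₀ pw : Polynomial ℕ, ∀ (n m t e : ℕ) (x : List Bool), x.length = n → p₀.eval (n * m) ≤ t →
        1 ≤ e →
          1 - 1 / (e : ℝ) ≤ uniformProb m
            {w | U.ktAt (pw.eval (t * e)) x + m ≤ U.ktAt t (x ++ w) + Nat.log 2 (pw.eval (t * e))}) :
    ∀ U : UniversalMachine,
      (∃ c : ℕ, distClass coNP {uniformEnsemble, tallyEnsemble} ⊆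
        Avg1DeltaP fun n => 1 - 1 / (n : ℝ) ^ c) →
      ∀ L ∈ UP, U.HasUniversalHeuristicScheme L :=
  Hirahara2021_UP_hasUHS_of_Avg1P_of_search (Hirahara2021_UP_searchUHS_of_Avg1P_of_leaves h42 h34 h52)

end Literature.Computability.MetaComplexity
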